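/-
Copyright (c) 2026 the pub-hodgecm-mathlib formalisation cell (harness21).  Prover seat hodgecm-mathlib-K2-defs1 (g7), Track B DEFS FILER (K2 currency desk ∕ R90-TF currency chair),
h413 = `stmt-HodgeConjecture-24833`, route `HCCMUnconditional`; R90-TF programme, section S8 «ContSpec-n½» (planner R90-CS-plan (g0)), deal D-S8-3 of RULING S8-R10 (b)
2026-09-04T16:10:27Z «the N = 3 character law is a PAIR: `IsChiSectionPair χ₁ χ₂ φ` + `middleEntryUnitary`»; twin of ★ `K2E1CharacterEisensteinU2Defs` §1–§2 (K2-defs1 (g6), p859441).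
-/
import Summits.HodgeConjecture.HodgeConjecture.Theorems.K2E1CharacterEisensteinU2Defs     -- ★ `firstEntryUnit`, `IsChiSection` (+ ★ `borelAdelic`, `adelicUnipotent`, `lastEntryUnit`, `toAdelic_mem_borelAdelic_of_mem_borelU`)
import Literature.NumberTheory.Automorphic.UnitaryGroupAdelicOneTorusDictionary           -- ★ `adelicOne`, `adelicOneEquivTorus`, `adelicOneChar`, `forall_adelicOneChar_eq_one_iff`, `TorusDict.torus`∕`IsAutomorphic`
import Literature.NumberTheory.Automorphic.UnitaryGroupQuasiSplitCMDatum                  -- ★ `StdForm.over_antidiagonal_apply` (the entries of `J_N`)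
import HarnessLib

/-!
# The PAIR currency of Borel characters on `U(J₃)`: all diagonal entries `bᵢᵢ` of `b ∈ B(𝔸_F)` as ideles, the unitarity law `c(bᵢᵢ)·b_{ī ī} = 1` (`ī = rev i`),
# the MIDDLE entry `b₁₁ ∈ U(1)(𝔸_F)` for `N = 3`, and `(χ₁, χ₂)`-sections `φ(b g) = χ₁(b₀₀)·χ₂(b₁₁)·φ(g)` — DEFINITIONS (+ trivial API)

Cell `pub/hodgecm-mathlib`, crux H413 = `stmt-HodgeConjecture-24833`.  DEFINITIONS FILE (`--kind definition`); no `instance`, no notation, no named-fact hypothesis, no `sorry`.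
Generic quadratic datum `F E c` (as ★ `K2E1CharacterEisensteinU2Defs`); §1–§2 are generic in `N` (no `NeZero` needed except for the two read-backs naming `0`∕`⊤`), §3–§4 are the `N = 3` leaf the S8 twins need.

WHY (R90-CS-plan RULING S8-R10, 2026-09-04T16:10:27Z).  ★ `IsChiSection χ φ` (generic `N`) reads ONLY `b₀₀` (`firstEntryUnit`): at `N = 3` that is the `χ₂ = 1` SUB-FAMILY of the
Borel characters `diag(a, β, ā⁻¹) ↦ χ₁(a)·χ₂(β)`, `β ∈ U(1)(𝔸_F)` (the norm-one ideles `c(β)β = 1`), whereas (13.6.1) ∕ §13.9 of [Rogawski1990] («Let `χ = (φ, ψ)` be a unitary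
character of `M\𝐌`», p. 229 l. 8; `M = {d(α, β, ᾱ⁻¹)}`) range over ALL pairs.  This leaf supplies the pair currency, C1-consistently with the tree's global `U(1)`-character type
(★ `↥(TorusDict.torus c) →ₜ* ℂˣ` + ★ `TorusDict.IsAutomorphic c`, the type of `ξ.η`, `ξ.ψ` in ★ `OneDimAutRepH` and of `ψ` in ★ `UnitaryGroup.detChar`∕`cmDetChar`∕S8's `charLine₃`),
and the read-back `IsChiSectionPair χ₁ χ₂ φ ↔ IsChiSection χ₁ φ` for trivial `χ₂`.  Census (C1): no GLOBAL Borel-pair type existed (★ `cmXiTorusChar`∕`torusCharPair` are LOCAL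
inducing data of ★ `UnitaryGroupBorelInduction`; the E1 `U3` Eisenstein estate is the `χ = 1`∕height currency).

* §1 (generic `N`) `diag_mul_apply_of_blockTriangular` (upper-triangular `(A B)ᵢᵢ = Aᵢᵢ Bᵢᵢ`), `apply_diag_mul_of_mem_borelAdelic`, **`diagEntryUnit hb i : (𝔸_E)ˣ`** (+ `coe_`, `_mul`, `_one`,
  `_eq_one_of_mem_adelicUnipotent`, `_toAdelic_mem_principalIdeles`, read-backs `firstEntryUnit_eq_diagEntryUnit_zero`, `lastEntryUnit_eq_diagEntryUnit_last`).
* §2 (generic `N`) the UNITARITY LAW on the diagonal of `B(𝔸_F) ≤ U(J_N)(𝔸_F)`: `mul_antidiagonal_apply` (`(X·J_N) i q = X i q̄`), **`conjAdele_diag_mul_diag_rev`**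
  (`c(bᵢᵢ) · b_{ī ī} = 1`) — from `ᵗ(c b) J_N b = J_N` (★ `adelicVal_mem_unitaryGroupOfForm`) read at the entry `(i, ī)`, upper-triangularity killing every other term.
* §3 (`N = 3`) **`middleEntryOne hb : adelicOne F E c`** (`b₁₁`, norm one since `1̄ = 1` in `Fin 3`) and **`middleEntryUnitary hb : ↥(TorusDict.torus c)`** (★ `adelicOneEquivTorus`)
  (+ `coe_`, `_mul`, `_one`, `_eq_one_of_mem_adelicUnipotent`, `apply_middleEntryUnitary_toAdelic_eq_one` for AUTOMORPHIC `χ₂` at rational `b ∈ B(F)`).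
* §4 (`N = 3`) **`IsChiSectionPair χ₁ χ₂ φ`** `:= ∀ b ∈ B(𝔸_F), ∀ g, φ (b g) = χ₁(b₀₀) · χ₂(b₁₁) · φ g` (+ `.borel_mul`, `.unipotent_mul`, `.toAdelic_mul` (needs `TorusDict.IsAutomorphic c χ₂`;
  `χ₁` is a ★ `HeckeCharacter`, trivial on principal ideles by ★ `map_principal`), `.zero ∕ .add ∕ .smul ∕ .mul_of_invariant`, read-back `isChiSectionPair_iff_isChiSection_of_trivial`).
-- TODO(general form): for general `N` the Levi of the Borel of `U(J_N)` is `{diag(a₁,…,a_m, [β], c(a_m)⁻¹,…,c(a₁)⁻¹)}` and the cuspidal datum is an `m`-tuple of Hecke characters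
-- (+ a `U(1)`-character when `N` is odd); only `N = 2` (★ U2Defs) and `N = 3` (here) are typed.
HONEST LABEL: HC_CM is proved only modulo the 7 printed citations (2 remaining named inputs: hLiu418 = `stmt-HodgeConjecture-24832`, h413 = `stmt-HodgeConjecture-24833`) until rung 0
closes; definitions only, count-neutral, closes no socket.

## References
* [Rogawski1990] J. D. Rogawski, *Automorphic Representations of Unitary Groups in Three Variables*, Ann. of Math. Stud. 123 (1990), §1.9–§1.10 pp. 8–9 (`B = MN`, `M = {d(α, β, ᾱ⁻¹)}`),
  §13.9 p. 229 («`χ = (φ, ψ)` a unitary character of `M\𝐌`»), (13.6.1) p. 208.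
* [MoeglinWaldspurger1995] C. Mœglin, J.-L. Waldspurger, *Spectral decomposition and Eisenstein series* (1995), I.2.17 (induced spaces, sections).
* [Mok2014] C. P. Mok, Mem. AMS 235 no. 1108 (2015), §1 Notation p. 5 (`U(1)_{E/F}` = norm-one ideles; `J_N`), §3.1 (`B`, `T`).
-/

set_option autoImplicit false
-- the mandated namespace repeats the single-problem summit's segment (`HodgeConjecture.HodgeConjecture`)
set_option linter.dupNamespace false

noncomputable section

open NumberField IsDedekindDomain MeasureTheory Matrix
open scoped NNReal MatrixGroups
open Literature.NumberTheory.Automorphic Literature.NumberTheory.Automorphic.UnitaryGroup AdelicGroupData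
open Literature.NumberTheory.Automorphic.Arthur2013.Leaves.TECR
open Literature.NumberTheory.GaloisRepresentations (HeckeCharacter ideleGroup principalIdeles)
open Summit.HodgeConjecture.HodgeConjecture.Cruxes.H413.K2E1BorelEisensteinU
open Summit.HodgeConjecture.HodgeConjecture.Cruxes.H413.K2E1CharacterEisensteinU2Defs

namespace Summit.HodgeConjecture.HodgeConjecture.Cruxes.H413.K2E1CharacterEisensteinU3PairDefs

variable {F E : Type} [Field F] [NumberField F] [Field E] [NumberField E] [Algebra F E] {c : E ≃ₐ[F] E} {N : ℕ}

/-! ## §1 All diagonal entries `bᵢᵢ` of `b ∈ B(𝔸_F)` as ideles (generic `N`) -/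

omit [NumberField F] [NumberField E] in
/-- For upper-triangular matrices the diagonal of a product is the product of the diagonals: `(A B)ᵢᵢ = Aᵢᵢ · Bᵢᵢ`. [folklore] -/
theorem diag_mul_apply_of_blockTriangular {R : Type*} [CommRing R] {A B : Matrix (Fin N) (Fin N) R} (hA : A.BlockTriangular id) (hB : B.BlockTriangular id)
    (i : Fin N) : (A * B) i i = A i i * B i i := by
  rw [Matrix.mul_apply, Finset.sum_eq_single i]
  · intro j _ hj
    rcases lt_or_gt_of_ne hj with h | h
    · rw [hA h, zero_mul]
    · rw [hB h, mul_zero]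
  · exact fun h => (h (Finset.mem_univ _)).elim

/-- For `b, b′ ∈ B(𝔸_F)` every diagonal entry is multiplicative: `(b b′)ᵢᵢ = bᵢᵢ · b′ᵢᵢ`. [cite: Rogawski1990, §1.10 p. 9] -/
theorem apply_diag_mul_of_mem_borelAdelic {b b' : (quasiSplit F E c N).Adelic} (hb : b ∈ borelAdelic F E c N) (hb' : b' ∈ borelAdelic F E c N) (i : Fin N) :
    (adelicVal F E c N _ (b * b') : Matrix (Fin N) (Fin N) (AdeleRing (𝓞 E) E)) i i =
      (adelicVal F E c N _ b : Matrix (Fin N) (Fin N) (AdeleRing (𝓞 E) E)) i i * (adelicVal F E c N _ b' : Matrix (Fin N) (Fin N) (AdeleRing (𝓞 E) E)) i i := by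
  rw [map_mul, Units.val_mul]
  exact diag_mul_apply_of_blockTriangular ((mem_borelAdelic_iff b).1 hb) ((mem_borelAdelic_iff b').1 hb') i

/-- **The `i`-th diagonal entry `bᵢᵢ` of `b ∈ B(𝔸_F)` as an idele of `E`** (its inverse is `(b⁻¹)ᵢᵢ`); `i = 0` is ★ `firstEntryUnit`, `i = N − 1` is ★ `lastEntryUnit`, and for
`N = 3`, `i = 1` is the middle coordinate `β` of the Levi `M = {d(α, β, ᾱ⁻¹)}`. [cite: Rogawski1990, §1.10 p. 9] -/
def diagEntryUnit {b : (quasiSplit F E c N).Adelic} (hb : b ∈ borelAdelic F E c N) (i : Fin N) : (AdeleRing (𝓞 E) E)ˣ where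
  val := (adelicVal F E c N _ b : Matrix (Fin N) (Fin N) (AdeleRing (𝓞 E) E)) i i
  inv := (adelicVal F E c N _ b⁻¹ : Matrix (Fin N) (Fin N) (AdeleRing (𝓞 E) E)) i i
  val_inv := by
    rw [← apply_diag_mul_of_mem_borelAdelic hb (Subgroup.inv_mem _ hb), mul_inv_cancel, map_one, Units.val_one, Matrix.one_apply_eq]
  inv_val := by
    rw [← apply_diag_mul_of_mem_borelAdelic (Subgroup.inv_mem _ hb) hb, inv_mul_cancel, map_one, Units.val_one, Matrix.one_apply_eq]

/-- `diagEntryUnit hb i = bᵢᵢ` (definitional). [cite: Rogawski1990, §1.10 p. 9] -/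
@[simp] theorem coe_diagEntryUnit {b : (quasiSplit F E c N).Adelic} (hb : b ∈ borelAdelic F E c N) (i : Fin N) :
    (diagEntryUnit hb i : AdeleRing (𝓞 E) E) = (adelicVal F E c N _ b : Matrix (Fin N) (Fin N) (AdeleRing (𝓞 E) E)) i i := rfl

/-- `b ↦ bᵢᵢ` is multiplicative on `B(𝔸_F)`. [cite: Rogawski1990, §1.10 p. 9] -/
theorem diagEntryUnit_mul {b b' : (quasiSplit F E c N).Adelic} (hb : b ∈ borelAdelic F E c N) (hb' : b' ∈ borelAdelic F E c N) (i : Fin N) :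
    diagEntryUnit (Subgroup.mul_mem _ hb hb') i = diagEntryUnit hb i * diagEntryUnit hb' i :=
  Units.ext (apply_diag_mul_of_mem_borelAdelic hb hb' i)

/-- `1ᵢᵢ = 1`. [folklore] -/
@[simp] theorem diagEntryUnit_one (i : Fin N) : diagEntryUnit (Subgroup.one_mem (borelAdelic F E c N)) i = 1 :=
  Units.ext (by rw [coe_diagEntryUnit, map_one, Units.val_one, Matrix.one_apply_eq, Units.val_one])

/-- For `u ∈ N(𝔸_F)` (upper unitriangular), `uᵢᵢ = 1`. [cite: Rogawski1990, §1.10 p. 9] -/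
theorem diagEntryUnit_eq_one_of_mem_adelicUnipotent {u : (quasiSplit F E c N).Adelic} (hu : u ∈ adelicUnipotent F E c N) (i : Fin N) :
    diagEntryUnit (adelicUnipotent_le_borelAdelic hu) i = 1 :=
  Units.ext (by rw [coe_diagEntryUnit, Units.val_one]; exact ((mem_upperUnitriangular_iff _).1 ((mem_adelicUnipotent_iff u).1 hu)).2 i)

/-- Read-back: ★ `firstEntryUnit hb = diagEntryUnit hb 0`. [cite: Rogawski1990, §1.10 p. 9] -/
theorem firstEntryUnit_eq_diagEntryUnit_zero [NeZero N] {b : (quasiSplit F E c N).Adelic} (hb : b ∈ borelAdelic F E c N) : firstEntryUnit hb = diagEntryUnit hb 0 :=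
  Units.ext rfl

/-- Read-back: ★ `lastEntryUnit hb = diagEntryUnit hb ⊤` (`⊤ = N − 1`). [cite: Rogawski1990, §1.10 p. 9] -/
theorem lastEntryUnit_eq_diagEntryUnit_last [NeZero N] {b : (quasiSplit F E c N).Adelic} (hb : b ∈ borelAdelic F E c N) : lastEntryUnit hb = diagEntryUnit hb ⊤ :=
  Units.ext rfl

/-- **For a RATIONAL Borel element `γ ∈ B(F)` every idele `γᵢᵢ` is principal** (the diagonal image of the non-zero `γᵢᵢ ∈ E`; twin of ★ `firstEntryUnit_toAdelic_mem_principalIdeles`).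
[cite: Rogawski1990, §1.9 p. 9] -/
theorem diagEntryUnit_toAdelic_mem_principalIdeles (γ : (quasiSplit F E c N).Rational) (hγ : (quasiSplit F E c N).toAdelic γ ∈ borelAdelic F E c N) (i : Fin N) :
    diagEntryUnit hγ i ∈ principalIdeles E := by
  have hinj := AdeleRing.algebraMap_injective (𝓞 E) E
  have hval : (diagEntryUnit hγ i : AdeleRing (𝓞 E) E) =
      algebraMap E (AdeleRing (𝓞 E) E) ((((show ↥(rational F E c N ((StdForm.antidiagonal N).over E)) from γ) : GL (Fin N) E) : Matrix (Fin N) (Fin N) E) i i) := rfl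
  have hinv : ((diagEntryUnit hγ i)⁻¹ : (AdeleRing (𝓞 E) E)ˣ).val =
      algebraMap E (AdeleRing (𝓞 E) E) ((((show ↥(rational F E c N ((StdForm.antidiagonal N).over E)) from γ⁻¹) : GL (Fin N) E) : Matrix (Fin N) (Fin N) E) i i) := by
    show (adelicVal F E c N _ ((quasiSplit F E c N).toAdelic γ)⁻¹ : Matrix (Fin N) (Fin N) (AdeleRing (𝓞 E) E)) i i = _
    rw [← map_inv]
    rfl
  refine ⟨⟨((((show ↥(rational F E c N ((StdForm.antidiagonal N).over E)) from γ) : GL (Fin N) E) : Matrix (Fin N) (Fin N) E) i i),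
    ((((show ↥(rational F E c N ((StdForm.antidiagonal N).over E)) from γ⁻¹) : GL (Fin N) E) : Matrix (Fin N) (Fin N) E) i i),
    hinj (by rw [map_mul, map_one, ← hval, ← hinv]; exact Units.mul_inv _), hinj (by rw [map_mul, map_one, ← hval, ← hinv]; exact Units.inv_mul _)⟩, Units.ext hval.symm⟩

/-! ## §2 The unitarity law on the diagonal of `B(𝔸_F) ≤ U(J_N)(𝔸_F)`: `c(bᵢᵢ) · b_{ī ī} = 1` (generic `N`) -/

omit [NumberField F] [NumberField E] in
/-- Right multiplication by the antidiagonal form permutes columns: `(X · J_N) i q = X i q̄` (`q̄ = rev q`). [cite: Mok2014, §1 Notation p. 5] -/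
theorem mul_antidiagonal_apply {R : Type*} [CommRing R] (X : Matrix (Fin N) (Fin N) R) (i q : Fin N) :
    (X * (StdForm.antidiagonal N).over R) i q = X i q.rev := by
  rw [Matrix.mul_apply, Finset.sum_eq_single q.rev]
  · rw [StdForm.over_antidiagonal_apply, if_pos, mul_one]
    rw [Fin.val_rev]; omega
  · intro p _ hp
    rw [StdForm.over_antidiagonal_apply, if_neg, mul_zero]
    intro h
    apply hp
    ext
    rw [Fin.val_rev]; omega
  · exact fun h => (h (Finset.mem_univ _)).elim

/-- **The unitarity law on the diagonal**: for `b ∈ B(𝔸_F) ≤ U(J_N)(𝔸_F)` and every `i`, `(c ⊗ 1)(bᵢᵢ) · b_{ī ī} = 1` with `ī = rev i` — the `(i, ī)` entry of `ᵗ(c b) J_N b = J_N`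
(★ `adelicVal_mem_unitaryGroupOfForm`), in which upper-triangularity leaves the single term `q = ī`.  For `N = 2`: `c(a)·d = 1` for `b = (a *; 0 d)`, i.e. `d = c(a)⁻¹`; for `N = 3`,
`i = 1 = ī`: the middle entry has norm one. [cite: Mok2014, §1 Notation p. 5] [cite: Rogawski1990, §1.9 p. 8] -/
theorem conjAdele_diag_mul_diag_rev {b : (quasiSplit F E c N).Adelic} (hb : b ∈ borelAdelic F E c N) (i : Fin N) :
    conjAdele F E c ((adelicVal F E c N _ b : Matrix (Fin N) (Fin N) (AdeleRing (𝓞 E) E)) i i) *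
      (adelicVal F E c N _ b : Matrix (Fin N) (Fin N) (AdeleRing (𝓞 E) E)) i.rev i.rev = 1 := by
  have hT : ((adelicVal F E c N _ b : Matrix (Fin N) (Fin N) (AdeleRing (𝓞 E) E))).BlockTriangular id := (mem_borelAdelic_iff b).1 hb
  have hU := mem_unitaryGroupOfForm_iff.1 (adelicVal_mem_unitaryGroupOfForm b)
  have h := congrFun (congrFun hU i) i.rev
  rw [StdForm.over_antidiagonal_apply, if_pos (by rw [Fin.val_rev]; omega), Matrix.mul_apply, Finset.sum_eq_single i.rev] at h
  · rwa [mul_antidiagonal_apply, Fin.rev_rev, Matrix.transpose_apply, Matrix.map_apply] at h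
  · intro q _ hq
    rw [mul_antidiagonal_apply, Matrix.transpose_apply, Matrix.map_apply]
    by_cases hlt : i < q.rev
    · -- `b (rev q) i = 0` by upper-triangularity
      have hz : (adelicVal F E c N _ b : Matrix (Fin N) (Fin N) (AdeleRing (𝓞 E) E)) q.rev i = 0 := hT hlt
      rw [hz, map_zero, zero_mul]
    · -- `rev q < i`, hence `rev i < q` and `b q (rev i) = 0`
      have hlt' : q.rev < i := lt_of_le_of_ne (not_lt.1 hlt) (fun h' => hq (by rw [← h', Fin.rev_rev]))
      have hlt'' : i.rev < q := by rwa [← Fin.rev_lt_rev, Fin.rev_rev] at hlt'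
      have hz : (adelicVal F E c N _ b : Matrix (Fin N) (Fin N) (AdeleRing (𝓞 E) E)) q i.rev = 0 := hT hlt''
      rw [hz, mul_zero]
  · exact fun h' => (h' (Finset.mem_univ _)).elim

/-- The unitarity law for the idele `diagEntryUnit`: `c(bᵢᵢ) · b_{ī ī} = 1` in `𝔸_E`. [cite: Mok2014, §1 Notation p. 5] -/
theorem conjAdele_diagEntryUnit_mul_diagEntryUnit_rev {b : (quasiSplit F E c N).Adelic} (hb : b ∈ borelAdelic F E c N) (i : Fin N) :
    conjAdele F E c (diagEntryUnit hb i : AdeleRing (𝓞 E) E) * (diagEntryUnit hb i.rev : AdeleRing (𝓞 E) E) = 1 :=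
  conjAdele_diag_mul_diag_rev hb i

/-! ## §3 `N = 3`: the middle entry `b₁₁ ∈ U(1)(𝔸_F)` -/

/-- In `Fin 3` the middle index is self-reversed: `rev 1 = 1`. [folklore] -/
theorem rev_one_fin_three : (1 : Fin 3).rev = 1 := by decide

/-- **The middle diagonal entry `b₁₁` of `b ∈ B(𝔸_F) ≤ U(J₃)(𝔸_F)` as a NORM-ONE idele** (`(c ⊗ 1)(b₁₁) · b₁₁ = 1`, §2 at `i = 1 = ī`): an element of ★ `adelicOne F E c = U(1)(𝔸_F)` — the
coordinate `β` of the Levi `M = {d(α, β, ᾱ⁻¹)}` of [Rogawski1990] §1.10. [cite: Rogawski1990, §1.10 p. 9] [cite: Mok2014, §1 Notation p. 5] -/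
def middleEntryOne {b : (quasiSplit F E c 3).Adelic} (hb : b ∈ borelAdelic F E c 3) : ↥(adelicOne F E c) :=
  ⟨diagEntryUnit hb 1, by
    rw [mem_adelicOne_iff, coe_diagEntryUnit]
    have h := conjAdele_diag_mul_diag_rev hb 1
    rwa [rev_one_fin_three] at h⟩

/-- Underlying idele: `middleEntryOne hb = b₁₁ = diagEntryUnit hb 1`. [cite: Rogawski1990, §1.10 p. 9] -/
@[simp] theorem coe_middleEntryOne {b : (quasiSplit F E c 3).Adelic} (hb : b ∈ borelAdelic F E c 3) :
    ((middleEntryOne hb : ↥(adelicOne F E c)) : (AdeleRing (𝓞 E) E)ˣ) = diagEntryUnit hb 1 := rfl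

/-- `b ↦ b₁₁` is multiplicative on `B(𝔸_F)` (in `U(1)(𝔸_F)`). [cite: Rogawski1990, §1.10 p. 9] -/
theorem middleEntryOne_mul {b b' : (quasiSplit F E c 3).Adelic} (hb : b ∈ borelAdelic F E c 3) (hb' : b' ∈ borelAdelic F E c 3) :
    middleEntryOne (Subgroup.mul_mem _ hb hb') = middleEntryOne hb * middleEntryOne hb' :=
  Subtype.ext (diagEntryUnit_mul hb hb' 1)

/-- `1₁₁ = 1`. [folklore] -/
@[simp] theorem middleEntryOne_one : middleEntryOne (Subgroup.one_mem (borelAdelic F E c 3)) = 1 :=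
  Subtype.ext (diagEntryUnit_one 1)

/-- For `u ∈ N(𝔸_F)`, `u₁₁ = 1`. [cite: Rogawski1990, §1.10 p. 9] -/
theorem middleEntryOne_eq_one_of_mem_adelicUnipotent {u : (quasiSplit F E c 3).Adelic} (hu : u ∈ adelicUnipotent F E c 3) :
    middleEntryOne (adelicUnipotent_le_borelAdelic hu) = 1 :=
  Subtype.ext (diagEntryUnit_eq_one_of_mem_adelicUnipotent hu 1)

/-- **The middle entry read in the tree's `U(1)`-torus `T(𝔸_F)`** (★ `TorusDict.torus c`, the domain of the automorphic `U(1)`-characters `ψ : ↥(TorusDict.torus c) →ₜ* ℂˣ` of ★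
`OneDimAutRepH` ∕ `detChar` ∕ S8's `charLine₃`), via the identity-on-ideles isomorphism ★ `adelicOneEquivTorus`. [cite: Rogawski1990, §1.10 p. 9] [cite: Mok2014, §1 Notation p. 5] -/
def middleEntryUnitary {b : (quasiSplit F E c 3).Adelic} (hb : b ∈ borelAdelic F E c 3) : ↥(TorusDict.torus c) :=
  adelicOneEquivTorus F E c (middleEntryOne hb)

/-- Underlying idele: `middleEntryUnitary hb = b₁₁`. [cite: Rogawski1990, §1.10 p. 9] -/
@[simp] theorem coe_middleEntryUnitary {b : (quasiSplit F E c 3).Adelic} (hb : b ∈ borelAdelic F E c 3) :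
    ((middleEntryUnitary hb : ↥(TorusDict.torus c)) : ideleGroup E) = diagEntryUnit hb 1 := by
  rw [middleEntryUnitary, coe_adelicOneEquivTorus, coe_middleEntryOne]

/-- `b ↦ b₁₁` is multiplicative on `B(𝔸_F)` (in `T(𝔸_F)`). [cite: Rogawski1990, §1.10 p. 9] -/
theorem middleEntryUnitary_mul {b b' : (quasiSplit F E c 3).Adelic} (hb : b ∈ borelAdelic F E c 3) (hb' : b' ∈ borelAdelic F E c 3) :
    middleEntryUnitary (Subgroup.mul_mem _ hb hb') = middleEntryUnitary hb * middleEntryUnitary hb' := by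
  rw [middleEntryUnitary, middleEntryOne_mul hb hb', map_mul]; rfl

/-- `1₁₁ = 1` in `T(𝔸_F)`. [folklore] -/
@[simp] theorem middleEntryUnitary_one : middleEntryUnitary (Subgroup.one_mem (borelAdelic F E c 3)) = 1 := by
  rw [middleEntryUnitary, middleEntryOne_one, map_one]

/-- For `u ∈ N(𝔸_F)`, `u₁₁ = 1` in `T(𝔸_F)`. [cite: Rogawski1990, §1.10 p. 9] -/
theorem middleEntryUnitary_eq_one_of_mem_adelicUnipotent {u : (quasiSplit F E c 3).Adelic} (hu : u ∈ adelicUnipotent F E c 3) :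
    middleEntryUnitary (adelicUnipotent_le_borelAdelic hu) = 1 := by
  rw [middleEntryUnitary, middleEntryOne_eq_one_of_mem_adelicUnipotent hu, map_one]

/-- `χ₂ (middleEntryUnitary hb) = adelicOneChar χ₂ (middleEntryOne hb)` (★ `adelicOneChar_apply`, definitional). [cite: Rogawski1990, §1.10 p. 9] -/
theorem apply_middleEntryUnitary (χ₂ : ↥(TorusDict.torus c) →ₜ* ℂˣ) {b : (quasiSplit F E c 3).Adelic} (hb : b ∈ borelAdelic F E c 3) :
    χ₂ (middleEntryUnitary hb) = adelicOneChar F E c χ₂ (middleEntryOne hb) := rfl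

/-- **An AUTOMORPHIC `U(1)`-character is trivial on the middle entry of a RATIONAL Borel element `γ ∈ B(F)`** (`γ₁₁` is a principal idele, §1; ★ `forall_adelicOneChar_eq_one_iff`).
[cite: Rogawski1990, §1.9 p. 9] -/
theorem apply_middleEntryUnitary_toAdelic_eq_one {χ₂ : ↥(TorusDict.torus c) →ₜ* ℂˣ} (hχ₂ : TorusDict.IsAutomorphic c χ₂) (γ : (quasiSplit F E c 3).Rational)
    (hγ : (quasiSplit F E c 3).toAdelic γ ∈ borelAdelic F E c 3) : χ₂ (middleEntryUnitary hγ) = 1 := by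
  rw [apply_middleEntryUnitary]
  exact (forall_adelicOneChar_eq_one_iff F E c χ₂).2 hχ₂ _ (diagEntryUnit_toAdelic_mem_principalIdeles γ hγ 1)

/-! ## §4 `N = 3`: `(χ₁, χ₂)`-sections -/

/-- **`(χ₁, χ₂)`-SECTIONS on `U(J₃)(𝔸_F)`**: `φ : G(𝔸_F) → ℂ` with `φ(b g) = χ₁(b₀₀)·χ₂(b₁₁)·φ(g)` for every `b ∈ B(𝔸_F)` — the exponent-`0` slice of the space induced from the Borel
character `d(α, β, ᾱ⁻¹) n ↦ χ₁(α) χ₂(β)` («`χ = (φ, ψ)` a unitary character of `M\𝐌`», [Rogawski1990] §13.9 p. 229), `χ₁` a ★ `HeckeCharacter E` read on the idele `b₀₀ = ★ firstEntryUnit`,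
`χ₂` a continuous character of the `U(1)`-torus ★ `TorusDict.torus c` read on `b₁₁ = middleEntryUnitary` (automorphy of `χ₂` is a HYPOTHESIS of the theorems that need it, not of the
definition).  The flat section ★ `flatSectionU φ z` then carries `(χ₁‖·‖^z, χ₂)`; `χ₂ = 1` recovers ★ `IsChiSection χ₁` (`isChiSectionPair_iff_isChiSection_of_trivial`).
[cite: Rogawski1990, §13.9 p. 229] [cite: MoeglinWaldspurger1995, I.2.17] -/
def IsChiSectionPair (χ₁ : HeckeCharacter E) (χ₂ : ↥(TorusDict.torus c) →ₜ* ℂˣ) (φ : (quasiSplit F E c 3).Adelic → ℂ) : Prop :=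
  ∀ (b : (quasiSplit F E c 3).Adelic) (hb : b ∈ borelAdelic F E c 3) (g : (quasiSplit F E c 3).Adelic),
    φ (b * g) = ((χ₁ (firstEntryUnit hb) : ℂˣ) : ℂ) * ((χ₂ (middleEntryUnitary hb) : ℂˣ) : ℂ) * φ g

namespace IsChiSectionPair

variable {χ₁ : HeckeCharacter E} {χ₂ : ↥(TorusDict.torus c) →ₜ* ℂˣ} {φ ψ : (quasiSplit F E c 3).Adelic → ℂ}

/-- The defining equivariance. [cite: MoeglinWaldspurger1995, I.2.17] -/
theorem borel_mul (hφ : IsChiSectionPair χ₁ χ₂ φ) {b : (quasiSplit F E c 3).Adelic} (hb : b ∈ borelAdelic F E c 3) (g : (quasiSplit F E c 3).Adelic) :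
    φ (b * g) = ((χ₁ (firstEntryUnit hb) : ℂˣ) : ℂ) * ((χ₂ (middleEntryUnitary hb) : ℂˣ) : ℂ) * φ g := hφ b hb g

/-- **`(χ₁, χ₂)`-sections are left-`N(𝔸_F)`-invariant** (`u₀₀ = 1 = u₁₁`). [cite: MoeglinWaldspurger1995, I.2.17] -/
theorem unipotent_mul (hφ : IsChiSectionPair χ₁ χ₂ φ) (u : ↥(adelicUnipotent F E c 3)) (g : (quasiSplit F E c 3).Adelic) :
    φ ((u : (quasiSplit F E c 3).Adelic) * g) = φ g := by
  rw [hφ.borel_mul (adelicUnipotent_le_borelAdelic u.2), firstEntryUnit_eq_one_of_mem_adelicUnipotent u.2, middleEntryUnitary_eq_one_of_mem_adelicUnipotent u.2,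
    map_one, map_one, Units.val_one, one_mul, one_mul]

/-- **`(χ₁, χ₂)`-sections are left-`B(F)`-invariant when `χ₂` is AUTOMORPHIC** (`χ₁` is trivial on principal ideles, ★ `HeckeCharacter.map_principal`; `χ₂` on the principal
`γ₁₁`, `apply_middleEntryUnitary_toAdelic_eq_one`) — the hypothesis `hφ` of ★ `flatSectionU_toAdelic_mul` ∕ `eisensteinSeriesU_*`. [cite: MoeglinWaldspurger1995, II.1.5] -/
theorem toAdelic_mul (hφ : IsChiSectionPair χ₁ χ₂ φ) (hχ₂ : TorusDict.IsAutomorphic c χ₂) :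
    ∀ b ∈ borelU (c : E →+* E) ((StdForm.antidiagonal 3).over E), ∀ x : (quasiSplit F E c 3).Adelic, φ ((quasiSplit F E c 3).toAdelic b * x) = φ x := fun b hb x => by
  rw [hφ.borel_mul (toAdelic_mem_borelAdelic_of_mem_borelU hb), HeckeCharacter.map_principal χ₁ (firstEntryUnit_toAdelic_mem_principalIdeles b _),
    apply_middleEntryUnitary_toAdelic_eq_one hχ₂ b _, Units.val_one, one_mul, one_mul]

/-- `0` is a `(χ₁, χ₂)`-section. [folklore] -/
theorem zero (χ₁ : HeckeCharacter E) (χ₂ : ↥(TorusDict.torus c) →ₜ* ℂˣ) : IsChiSectionPair (F := F) χ₁ χ₂ 0 := fun _ _ _ => by simp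

/-- Sums of `(χ₁, χ₂)`-sections. [folklore] -/
theorem add (hφ : IsChiSectionPair χ₁ χ₂ φ) (hψ : IsChiSectionPair χ₁ χ₂ ψ) : IsChiSectionPair χ₁ χ₂ (φ + ψ) := fun b hb g => by
  simp only [Pi.add_apply, hφ b hb g, hψ b hb g, mul_add]

/-- Scalar multiples of `(χ₁, χ₂)`-sections. [folklore] -/
theorem smul (hφ : IsChiSectionPair χ₁ χ₂ φ) (a : ℂ) : IsChiSectionPair χ₁ χ₂ (a • φ) := fun b hb g => by
  simp only [Pi.smul_apply, smul_eq_mul, hφ b hb g]; ring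

/-- **A `(χ₁, χ₂)`-section times a left-`B(𝔸_F)`-invariant function is a `(χ₁, χ₂)`-section** (right `K`-type and finite-level factors attach this way). [cite: MoeglinWaldspurger1995, I.2.17] -/
theorem mul_of_invariant (hφ : IsChiSectionPair χ₁ χ₂ φ) (hψ : ∀ (b : (quasiSplit F E c 3).Adelic), b ∈ borelAdelic F E c 3 → ∀ g : (quasiSplit F E c 3).Adelic, ψ (b * g) = ψ g) :
    IsChiSectionPair χ₁ χ₂ (φ * ψ) := fun b hb g => by
  simp only [Pi.mul_apply, hφ b hb g, hψ b hb g, mul_assoc]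

end IsChiSectionPair

/-- **READ-BACK: for a `χ₂` trivial on `T(𝔸_F)`, `(χ₁, χ₂)`-sections are exactly the ★ `χ₁`-sections of `K2E1CharacterEisensteinU2Defs`** (the `χ₂ = 1` sub-family of RULING S8-R10).
[cite: MoeglinWaldspurger1995, I.2.17] -/
theorem isChiSectionPair_iff_isChiSection_of_trivial {χ₁ : HeckeCharacter E} {χ₂ : ↥(TorusDict.torus c) →ₜ* ℂˣ} (hχ₂ : ∀ t : ↥(TorusDict.torus c), χ₂ t = 1)
    {φ : (quasiSplit F E c 3).Adelic → ℂ} : IsChiSectionPair χ₁ χ₂ φ ↔ IsChiSection χ₁ φ := by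
  refine ⟨fun h b hb g => ?_, fun h b hb g => ?_⟩
  · rw [h b hb g, hχ₂, Units.val_one, mul_one]
  · rw [h b hb g, hχ₂, Units.val_one, mul_one]

/-- A `(χ₁, χ₂)`-section with trivial `χ₂` is a `χ₁`-section. [cite: MoeglinWaldspurger1995, I.2.17] -/
theorem IsChiSectionPair.isChiSection_of_trivial {χ₁ : HeckeCharacter E} {χ₂ : ↥(TorusDict.torus c) →ₜ* ℂˣ} (hχ₂ : ∀ t : ↥(TorusDict.torus c), χ₂ t = 1)
    {φ : (quasiSplit F E c 3).Adelic → ℂ} (hφ : IsChiSectionPair χ₁ χ₂ φ) : IsChiSection χ₁ φ :=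
  (isChiSectionPair_iff_isChiSection_of_trivial hχ₂).1 hφ

/-- A `χ₁`-section is a `(χ₁, χ₂)`-section for every `χ₂` trivial on `T(𝔸_F)`. [cite: MoeglinWaldspurger1995, I.2.17] -/
theorem IsChiSection.isChiSectionPair_of_trivial {χ₁ : HeckeCharacter E} {χ₂ : ↥(TorusDict.torus c) →ₜ* ℂˣ} (hχ₂ : ∀ t : ↥(TorusDict.torus c), χ₂ t = 1)
    {φ : (quasiSplit F E c 3).Adelic → ℂ} (hφ : IsChiSection χ₁ φ) : IsChiSectionPair χ₁ χ₂ φ :=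
  (isChiSectionPair_iff_isChiSection_of_trivial hχ₂).2 hφ

end Summit.HodgeConjecture.HodgeConjecture.Cruxes.H413.K2E1CharacterEisensteinU3PairDefs

end
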